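/-
Copyright: lead seat `ym-line-sll-p1` (prover-ym-line-sll-p1-g0-0), route `SoftLoopLongLag`, crux `ColdBoxSoftLoopLagFloor`
(stmt-QuantumFields-24180; stubs E1a `stub_innerFlatLagFloorG`, E1b `stub_innerDatumCovStabilityG` of `Cruxes/ColdBoxSoftLoopLagFloor/Lines/birth.lean` v7).
-/
import Summits.QuantumFields.YangMills.Theorems.WeakCouplingRatesColdBoxDirichletWick
import Summits.QuantumFields.YangMills.Theorems.WeakCouplingRatesColdBoxColours
import Summits.QuantumFields.YangMills.Theorems.ColdBoxAllGroupsOneScaleDefs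
import Summits.QuantumFields.YangMills.Theorems.SoftLoopLongLagDefs

/-!
# The Gaussian side of the loop stubs E1a/E1b: surface circulations of the Dirichlet Gaussian, their Wick identity, and the
# colour covariance `Cov_{gaussD}(q_S, q_{S'}) = (D/2)·M_D(S,S')²` (route `SoftLoopLongLag`, G-free)

WHAT.  On the sibling engine's Gaussian reference (`WeakCouplingRates.boxDirichlet H` = the temporal-gauge Dirichlet lattice Maxwell Gaussian of
the cold-wall box `[0,2H]⁴`, `ColdBoxAllGroups.gaussD H D` = its `D` colour copies) we set up the LOOP analogue of the plaquette surrogate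
`ColdBoxAllGroups.qObsD`:
* `dirSurfCirc H S s = Σ_{p ∈ S} dirCirc H p s` — the circulation of the Dirichlet field through a finite plaquette set `S` (for the spanning surface
  of an `R×R` square this is the abelian loop holonomy phase, Stokes); a centred Gaussian process indexed by `S` (`isGaussianProcess_dirSurfCirc`,
  from Mathlib's `IsGaussianProcess.of_isGaussianProcess` via the general `isGaussianProcess_finsetSum`);
* `dirSurfInductance H S S' = Σ_{p∈S} Σ_{q∈S'} boxDirProjKernel H p q = E_D[ℓ_S ℓ_{S'}]` — the Dirichlet mutual inductance
  (`integral_dirSurfCirc_mul`; for two squares near the centre it is the free `mutualInductance` up to `K·R⁴/H⁴`, width seat ym-line-sll-p4's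
  `exists_abs_dirInductance_sub_mutualInductance_le`);
* Wick: `E_D[ℓ_S² ℓ_{S'}²] − E_D[ℓ_S²]E_D[ℓ_{S'}²] = 2·M_D(S,S')²` (`integral_dirSurfCirc_sq_mul_sq_sub`, tree `GaussianWick.integral_prod_four`);
* the loop surrogate `qSurfD H D S t = ½ Σ_c ℓ_S(t_c)²` and the colour identity `Cov_{gaussD}(q_S, q_{S'}) = (D/2)·M_D(S,S')²`
  (`cov_qSurfD_gaussD_eq`, tree `cov_colourSum_pi`) — the Gaussian main term of E1a (flat datum), summed over the time-zero cube it is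
  `(D/2)·Σ_{x,x'} M_D(S_x, S_{x'+Re₀})²`, the Dirichlet form of `(D/2)·wickLagSum R R`;
* `loopSurf x R` — the tree's `rectSurface x R R` read as `Plaq 4`s, with `dirSurfInductance_loopSurf` matching ym-line-sll-p4's double sums.

WHY.  Stubs E1a/E1b compare `β²·Cov` under the cold-wall box kernel with exactly this Gaussian covariance (one-scale expansion in the exponential
chart, `D = dimE r.ρ` colours); this file is the model-side bookkeeping, uniform in the surfaces.

HONEST LABEL.  Free-field bookkeeping for a RECORD-label rung line (R2xi-G, leaf `WeakCouplingRates.XiPow` = an UPPER bound on the lattice mass gap,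
all compact simple `G`); NOT the Clay mass gap; no summit statement is touched.

References: S. Janson, *Gaussian Hilbert Spaces* (1997) Thm 1.28 (Wick); S. Chatterjee, arXiv:1602.01222 §13.
-/

set_option autoImplicit false

noncomputable section

open MeasureTheory ProbabilityTheory Finset
open scoped ENNReal
open Literature.Probability.LatticeModels (Site)
open Literature.MathematicalPhysics.QuantumLattice
open Literature.MathematicalPhysics.QuantumFieldTheory
open Summit.QuantumFields.YangMills.Theorems.WeakCouplingRates
open Summit.QuantumFields.YangMills.Theorems.ColdBoxAllGroups (TSpaceD gaussD)

namespace Summit.QuantumFields.YangMills.Theorems.SoftLoopLongLag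

/-! ## Finite sums of a Gaussian process form a Gaussian process -/

/-- **Finite sums of a real Gaussian process form a Gaussian process** (indexed by the finite index sets). -/
theorem isGaussianProcess_finsetSum {T Ω : Type*} [MeasurableSpace Ω] {P : Measure Ω} {X : T → Ω → ℝ}
    (hX : IsGaussianProcess X P) : IsGaussianProcess (fun (S : Finset T) ω => ∑ t ∈ S, X t ω) P := by
  classical
  refine hX.of_isGaussianProcess fun S => ?_
  refine ⟨S, ∑ t ∈ S.attach, ContinuousLinearMap.proj (R := ℝ) (φ := fun _ : ↥S => ℝ) t, fun ω => ?_⟩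
  rw [FunLike.coe_sum, Finset.sum_apply, ← Finset.sum_attach S (fun t => X t ω)]
  rfl

/-! ## Surface circulations of the Dirichlet Gaussian -/

variable {H : ℕ}

/-- The circulation of the Dirichlet free edge variables through a finite set of plaquettes `S` (for the spanning surface of a square:
the abelian loop phase, by Stokes). -/
def dirSurfCirc (H : ℕ) (S : Finset (Plaq 4)) (s : EuclideanSpace ℝ (DirFree H)) : ℝ := ∑ p ∈ S, dirCirc H p s

/-- `dirSurfCirc` is measurable. -/
theorem measurable_dirSurfCirc (S : Finset (Plaq 4)) : Measurable (dirSurfCirc H S) :=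
  Finset.measurable_sum _ fun p _ => measurable_dirCirc p

/-- **The surface circulation process is Gaussian** under `boxDirichlet H`. -/
theorem isGaussianProcess_dirSurfCirc (H : ℕ) : IsGaussianProcess (dirSurfCirc H) (boxDirichlet H) := by
  change IsGaussianProcess (fun (S : Finset (Plaq 4)) (s : EuclideanSpace ℝ (DirFree H)) => ∑ p ∈ S, dirCirc H p s) _
  exact isGaussianProcess_finsetSum (isGaussianProcess_dirCirc H)

/-- Every surface circulation has moments of all orders. -/
theorem memLp_dirSurfCirc (S : Finset (Plaq 4)) {p : ℝ≥0∞} (hp : p ≠ ∞) : MemLp (dirSurfCirc H S) p (boxDirichlet H) :=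
  ((isGaussianProcess_dirSurfCirc H).hasGaussianLaw_eval S).memLp hp

/-- Products of two surface circulations are integrable. -/
theorem integrable_dirSurfCirc_mul (S S' : Finset (Plaq 4)) :
    Integrable (fun s => dirSurfCirc H S s * dirSurfCirc H S' s) (boxDirichlet H) :=
  (memLp_dirSurfCirc S (by norm_num : (2 : ℝ≥0∞) ≠ ∞)).integrable_mul (memLp_dirSurfCirc S' (by norm_num : (2 : ℝ≥0∞) ≠ ∞))

/-- **Surface circulations are centred.** -/
theorem integral_dirSurfCirc (S : Finset (Plaq 4)) : ∫ s, dirSurfCirc H S s ∂(boxDirichlet H) = 0 := by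
  unfold dirSurfCirc
  rw [integral_finsetSum _ fun p _ => ((isGaussianProcess_dirCirc H).hasGaussianLaw_eval p).integrable]
  exact Finset.sum_eq_zero fun p _ => integral_dirCirc p

/-- **The Dirichlet mutual inductance** of two plaquette sets: `M_D(S,S') = Σ_{p∈S} Σ_{q∈S'} boxDirProjKernel H p q`. -/
def dirSurfInductance (H : ℕ) (S S' : Finset (Plaq 4)) : ℝ := ∑ p ∈ S, ∑ q ∈ S', boxDirProjKernel H p q

/-- `E_D[s(p)s(q)] = boxDirProjKernel H p q` (the tree's `integral_dirCirc_mul`, named form). -/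
theorem integral_dirCirc_mul_eq_boxDirProjKernel (p q : Plaq 4) :
    ∫ s, dirCirc H p s * dirCirc H q s ∂(boxDirichlet H) = boxDirProjKernel H p q :=
  integral_dirCirc_mul p q

/-- `boxDirProjKernel` is symmetric. -/
theorem boxDirProjKernel_comm (p q : Plaq 4) : boxDirProjKernel H p q = boxDirProjKernel H q p := by
  rw [← integral_dirCirc_mul_eq_boxDirProjKernel, ← integral_dirCirc_mul_eq_boxDirProjKernel]
  exact integral_congr_ae (ae_of_all _ fun s => mul_comm _ _)

/-- `dirSurfInductance` is symmetric. -/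
theorem dirSurfInductance_comm (S S' : Finset (Plaq 4)) : dirSurfInductance H S S' = dirSurfInductance H S' S := by
  unfold dirSurfInductance
  rw [Finset.sum_comm]
  exact Finset.sum_congr rfl fun q _ => Finset.sum_congr rfl fun p _ => boxDirProjKernel_comm p q

/-- **Two-point function of surface circulations = Dirichlet mutual inductance**: `E_D[ℓ_S ℓ_{S'}] = M_D(S,S')`. -/
theorem integral_dirSurfCirc_mul (S S' : Finset (Plaq 4)) :
    ∫ s, dirSurfCirc H S s * dirSurfCirc H S' s ∂(boxDirichlet H) = dirSurfInductance H S S' := by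
  have hint : ∀ p q : Plaq 4, Integrable (fun s => dirCirc H p s * dirCirc H q s) (boxDirichlet H) := fun p q =>
    ((isGaussianProcess_dirCirc H).hasGaussianLaw_eval p).memLp_two.integrable_mul
      ((isGaussianProcess_dirCirc H).hasGaussianLaw_eval q).memLp_two
  simp only [dirSurfCirc, Finset.sum_mul_sum]
  rw [integral_finsetSum _ fun p _ => integrable_finsetSum _ fun q _ => hint p q]
  refine Finset.sum_congr rfl fun p _ => ?_
  rw [integral_finsetSum _ fun q _ => hint p q]
  exact Finset.sum_congr rfl fun q _ => integral_dirCirc_mul p q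

/-- **Wick / Isserlis for squared surface circulations**: `E_D[ℓ_S² ℓ_{S'}²] − E_D[ℓ_S²]·E_D[ℓ_{S'}²] = 2·M_D(S,S')²`. -/
theorem integral_dirSurfCirc_sq_mul_sq_sub (S S' : Finset (Plaq 4)) :
    (∫ s, dirSurfCirc H S s ^ 2 * dirSurfCirc H S' s ^ 2 ∂(boxDirichlet H)) -
        (∫ s, dirSurfCirc H S s ^ 2 ∂(boxDirichlet H)) * (∫ s, dirSurfCirc H S' s ^ 2 ∂(boxDirichlet H)) =
      2 * dirSurfInductance H S S' ^ 2 := by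
  have h4 := Literature.Probability.Distributions.GaussianWick.integral_prod_four (isGaussianProcess_dirSurfCirc H)
    integral_dirSurfCirc ![S, S, S', S']
  simp only [Matrix.cons_val_zero, Matrix.cons_val_one] at h4
  have e2 : (![S, S, S', S'] : Fin 4 → Finset (Plaq 4)) 2 = S' := rfl
  have e3 : (![S, S, S', S'] : Fin 4 → Finset (Plaq 4)) 3 = S' := rfl
  rw [e2, e3] at h4
  have hl : ∀ s : EuclideanSpace ℝ (DirFree H), dirSurfCirc H S s ^ 2 * dirSurfCirc H S' s ^ 2 =
      dirSurfCirc H S s * dirSurfCirc H S s * dirSurfCirc H S' s * dirSurfCirc H S' s := fun s => by ring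
  have hp2 : ∀ s : EuclideanSpace ℝ (DirFree H), dirSurfCirc H S s ^ 2 = dirSurfCirc H S s * dirSurfCirc H S s := fun s => by ring
  have hq2 : ∀ s : EuclideanSpace ℝ (DirFree H), dirSurfCirc H S' s ^ 2 = dirSurfCirc H S' s * dirSurfCirc H S' s :=
    fun s => by ring
  simp_rw [hl, hp2, hq2, h4, integral_dirSurfCirc_mul]
  ring

/-! ## The loop surrogate with `D` colours and its Gaussian covariance -/

/-- **The quadratic (Gaussian) surrogate of `β·(loop cost)`** with `D` colours for the plaquette set `S`:
`qSurfD H D S t = ½ Σ_c ℓ_S(t_c)²` (the loop analogue of `ColdBoxAllGroups.qObsD`). -/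
def qSurfD (H D : ℕ) (S : Finset (Plaq 4)) (t : TSpaceD H D) : ℝ := 1 / 2 * ∑ i, dirSurfCirc H S (t i) ^ 2

/-- `qSurfD` as a colour sum. -/
theorem qSurfD_eq_sum (D : ℕ) (S : Finset (Plaq 4)) (t : TSpaceD H D) :
    qSurfD H D S t = ∑ i, 1 / 2 * dirSurfCirc H S (t i) ^ 2 := by
  rw [qSurfD, Finset.mul_sum]

/-- `qSurfD` is nonnegative. -/
theorem qSurfD_nonneg (D : ℕ) (S : Finset (Plaq 4)) (t : TSpaceD H D) : 0 ≤ qSurfD H D S t := by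
  unfold qSurfD; positivity

/-- `½ ℓ_S² ∈ L²(boxDirichlet)` (Gaussian moments). -/
theorem memLp_two_half_dirSurfCirc_sq (S : Finset (Plaq 4)) :
    MemLp (fun s => 1 / 2 * dirSurfCirc H S s ^ 2) 2 (boxDirichlet H) := by
  have hmeas : Measurable fun s => 1 / 2 * dirSurfCirc H S s ^ 2 :=
    measurable_const.mul ((measurable_dirSurfCirc S).pow_const 2)
  refine (memLp_two_iff_integrable_sq hmeas.aestronglyMeasurable).2 ?_
  have h4 : MemLp (dirSurfCirc H S) ((4 : ℕ) : ℝ≥0∞) (boxDirichlet H) := memLp_dirSurfCirc S (by simp)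
  have hint4 := h4.integrable_norm_pow (by norm_num)
  refine (hint4.const_mul (1 / 4)).congr (ae_of_all _ fun s => ?_)
  simp only [Real.norm_eq_abs, Even.pow_abs (by decide : Even 4)]
  ring

/-- **The colour identity for loops**: `Cov_{gaussD}(q_S, q_{S'}) = (D/2)·M_D(S,S')²`. -/
theorem cov_qSurfD_gaussD_eq (D : ℕ) (S S' : Finset (Plaq 4)) :
    (∫ t, qSurfD H D S t * qSurfD H D S' t ∂(gaussD H D)) -
        (∫ t, qSurfD H D S t ∂(gaussD H D)) * (∫ t, qSurfD H D S' t ∂(gaussD H D)) =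
      (D : ℝ) / 2 * dirSurfInductance H S S' ^ 2 := by
  have h := cov_colourSum_pi (ι := Fin D) (boxDirichlet H) (fun s => 1 / 2 * dirSurfCirc H S s ^ 2)
    (fun s => 1 / 2 * dirSurfCirc H S' s ^ 2) (memLp_two_half_dirSurfCirc_sq S) (memLp_two_half_dirSurfCirc_sq S')
  simp only [← qSurfD_eq_sum] at h
  rw [gaussD, h, Fintype.card_fin]
  have e1 : ∫ s, 1 / 2 * dirSurfCirc H S s ^ 2 * (1 / 2 * dirSurfCirc H S' s ^ 2) ∂(boxDirichlet H) =
      1 / 4 * ∫ s, dirSurfCirc H S s ^ 2 * dirSurfCirc H S' s ^ 2 ∂(boxDirichlet H) := by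
    rw [← integral_const_mul]; refine integral_congr_ae (ae_of_all _ fun s => ?_); ring
  have e2 : ∫ s, 1 / 2 * dirSurfCirc H S s ^ 2 ∂(boxDirichlet H) = 1 / 2 * ∫ s, dirSurfCirc H S s ^ 2 ∂(boxDirichlet H) :=
    integral_const_mul _ _
  have e3 : ∫ s, 1 / 2 * dirSurfCirc H S' s ^ 2 ∂(boxDirichlet H) = 1 / 2 * ∫ s, dirSurfCirc H S' s ^ 2 ∂(boxDirichlet H) :=
    integral_const_mul _ _
  rw [e1, e2, e3]
  have hW := integral_dirSurfCirc_sq_mul_sq_sub (H := H) S S'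
  linear_combination (D : ℝ) / 4 * hW

/-! ## Covariances of finite sums (bilinearity bookkeeping for the cube-smeared observable) -/

/-- **Bilinearity of the connected two-point function** over finite sums of `L²` observables. -/
theorem cov_sum_sum {Ω ι κ : Type*} [MeasurableSpace Ω] (μ : Measure Ω) [IsProbabilityMeasure μ] (A : Finset ι) (B : Finset κ)
    (f : ι → Ω → ℝ) (g : κ → Ω → ℝ) (hf : ∀ i ∈ A, MemLp (f i) 2 μ) (hg : ∀ j ∈ B, MemLp (g j) 2 μ) :
    (∫ ω, (∑ i ∈ A, f i ω) * (∑ j ∈ B, g j ω) ∂μ) - (∫ ω, ∑ i ∈ A, f i ω ∂μ) * (∫ ω, ∑ j ∈ B, g j ω ∂μ) =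
      ∑ i ∈ A, ∑ j ∈ B, ((∫ ω, f i ω * g j ω ∂μ) - (∫ ω, f i ω ∂μ) * (∫ ω, g j ω ∂μ)) := by
  have hfi : ∀ i ∈ A, Integrable (f i) μ := fun i hi => (hf i hi).integrable one_le_two
  have hgi : ∀ j ∈ B, Integrable (g j) μ := fun j hj => (hg j hj).integrable one_le_two
  have hfg : ∀ i ∈ A, ∀ j ∈ B, Integrable (fun ω => f i ω * g j ω) μ := fun i hi j hj => (hf i hi).integrable_mul (hg j hj)
  simp_rw [Finset.sum_mul_sum]
  rw [integral_finsetSum _ fun i hi => integrable_finsetSum _ fun j hj => hfg i hi j hj,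
    integral_finsetSum _ hfi, integral_finsetSum _ hgi, Finset.sum_mul_sum]
  rw [← Finset.sum_sub_distrib]
  refine Finset.sum_congr rfl fun i hi => ?_
  rw [integral_finsetSum _ fun j hj => hfg i hi j hj, ← Finset.sum_sub_distrib]

/-! ## The spanning surfaces of the route's squares -/

/-- A `ℤ⁴` plaquette of the tree (`ZdPlaquette 4`, ordered plane as a subtype) read as a `Plaq 4` (site, two directions). -/
def toPlaq (p : ZdPlaquette 4) : Plaq 4 := (p.1, p.2.1.1, p.2.1.2)

/-- `toPlaq` is injective. -/
theorem toPlaq_injective : Function.Injective toPlaq := by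
  rintro ⟨x, ⟨⟨i, j⟩, hij⟩⟩ ⟨y, ⟨⟨k, l⟩, hkl⟩⟩ h
  simp only [toPlaq, Prod.mk.injEq] at h
  obtain ⟨rfl, rfl, rfl⟩ := h
  rfl

/-- The spanning surface of the `R×R` square at `x` in the `(1,2)` plane (tree `rectSurface x R R`) as a set of `Plaq 4`s. -/
def loopSurf (x : Site 4) (R : ℕ) : Finset (Plaq 4) := (rectSurface x R R).image toPlaq

/-- The Dirichlet inductance of two squares is the double sum over the tree's `rectSurface`s (the form used by `SoftLoopLongLagDirichletLoopInductance`). -/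
theorem dirSurfInductance_loopSurf (H : ℕ) (x y : Site 4) (R : ℕ) :
    dirSurfInductance H (loopSurf x R) (loopSurf y R) =
      ∑ p ∈ rectSurface x R R, ∑ q ∈ rectSurface y R R,
        boxDirProjKernel H ((p.1, p.2.1.1, p.2.1.2) : Plaq 4) ((q.1, q.2.1.1, q.2.1.2) : Plaq 4) := by
  unfold dirSurfInductance loopSurf
  rw [Finset.sum_image fun p _ q _ h => toPlaq_injective h]
  refine Finset.sum_congr rfl fun p _ => ?_
  rw [Finset.sum_image fun p _ q _ h => toPlaq_injective h]
  rfl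

/-- The surface circulation of a square is the sum over the tree's `rectSurface`. -/
theorem dirSurfCirc_loopSurf (x : Site 4) (R : ℕ) (s : EuclideanSpace ℝ (DirFree H)) :
    dirSurfCirc H (loopSurf x R) s = ∑ p ∈ rectSurface x R R, dirCirc H ((p.1, p.2.1.1, p.2.1.2) : Plaq 4) s := by
  unfold dirSurfCirc loopSurf
  rw [Finset.sum_image fun p _ q _ h => toPlaq_injective h]
  rfl

/-- **The Gaussian main term of E1a, summed over the time-zero cube**: for any centre `c` and lag `T`,
`Σ_{x,x' ∈ cube_R} Cov_{gaussD}(q_{S(x+c)}, q_{S(x'+c+Te₀)}) = (D/2)·Σ_{x,x'} M_D(S(x+c), S(x'+c+Te₀))²`. -/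
theorem sum_sum_cov_qSurfD_loopSurf_eq (D : ℕ) (c : Site 4) (R T : ℕ) :
    ∑ x ∈ timeZeroCube R, ∑ x' ∈ timeZeroCube R,
        ((∫ t, qSurfD H D (loopSurf (x + c) R) t * qSurfD H D (loopSurf (x' + c + Pi.single 0 (T : ℤ)) R) t ∂(gaussD H D)) -
          (∫ t, qSurfD H D (loopSurf (x + c) R) t ∂(gaussD H D)) *
            (∫ t, qSurfD H D (loopSurf (x' + c + Pi.single 0 (T : ℤ)) R) t ∂(gaussD H D))) =
      (D : ℝ) / 2 * ∑ x ∈ timeZeroCube R, ∑ x' ∈ timeZeroCube R,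
        dirSurfInductance H (loopSurf (x + c) R) (loopSurf (x' + c + Pi.single 0 (T : ℤ)) R) ^ 2 := by
  rw [Finset.mul_sum]
  refine Finset.sum_congr rfl fun x _ => ?_
  rw [Finset.mul_sum]
  exact Finset.sum_congr rfl fun x' _ => cov_qSurfD_gaussD_eq D _ _

end Summit.QuantumFields.YangMills.Theorems.SoftLoopLongLag

end
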